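import Mathlib

/-!
# Card `baire-uniformise-the-gap` — the abstract uniformisation lemma, PROVED

Banach–Steinhaus for EVENTUALLY bounded BILINEAR families: pointwise-in-the-pair constants and
thresholds (`∀ x y, ∃ C N, ∀ k ≥ N, ∀ j, |b k j x y| ≤ C · w k j`, the literal shape of
`QCDScheme.HasLatticeMassGap` read on a Banach space of observables, `w k (S,n) = exp (−Δ a_k n)`)
upgrade to ONE constant and ONE threshold in product form `K ‖x‖ ‖y‖ · w k j`.
Proof: Baire category on `X × X` + four-point polarisation + scaling.
-/

open Filter Topology Set

namespace Summit.QuantumFields.QCD.Cruxes.ContinuumFromLatticeGap.Ideator1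

theorem eventually_uniform_of_pointwise {X : Type*} [NormedAddCommGroup X] [NormedSpace ℝ X]
    [CompleteSpace X] {J : Type*} (b : ℕ → J → X →L[ℝ] X →L[ℝ] ℝ) (w : ℕ → J → ℝ)
    (hw : ∀ k j, 0 < w k j)
    (h : ∀ x y : X, ∃ C : ℝ, ∃ N : ℕ, ∀ k ≥ N, ∀ j, |b k j x y| ≤ C * w k j) :
    ∃ K : ℝ, ∃ N : ℕ, ∀ k ≥ N, ∀ j, ∀ x y : X, |b k j x y| ≤ K * ‖x‖ * ‖y‖ * w k j := by
  -- the closed sets of the Baire argument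
  let E : ℕ → Set (X × X) := fun N => {p | ∀ k ≥ N, ∀ j, |b k j p.1 p.2| ≤ N * w k j}
  have hE : ∀ N, IsClosed (E N) := by
    intro N
    have hEq : E N = ⋂ k, ⋂ (_ : N ≤ k), ⋂ j, {p : X × X | |b k j p.1 p.2| ≤ N * w k j} := by
      ext p; simp [E]
    rw [hEq]
    refine isClosed_iInter fun k => isClosed_iInter fun _ => isClosed_iInter fun j => ?_
    exact isClosed_le (continuous_abs.comp (b k j).continuous₂) continuous_const
  have hU : (⋃ N, E N) = univ := by
    ext p
    simp only [mem_iUnion, mem_univ, iff_true]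
    obtain ⟨C, N, hN⟩ := h p.1 p.2
    refine ⟨max N ⌈C⌉₊, fun k hk j => (hN k ((le_max_left _ _).trans hk) j).trans ?_⟩
    have hC : C ≤ ((max N ⌈C⌉₊ : ℕ) : ℝ) :=
      (Nat.le_ceil C).trans (by exact_mod_cast le_max_right _ _)
    exact mul_le_mul_of_nonneg_right hC (hw k j).le
  obtain ⟨N, p₀, hp₀⟩ := nonempty_interior_of_iUnion_of_closed hE hU
  rw [mem_interior_iff_mem_nhds, Metric.mem_nhds_iff] at hp₀
  obtain ⟨r, hr, hball⟩ := hp₀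
  -- membership of translated pairs in the good set
  have mem : ∀ u v : X, ‖u‖ < r → ‖v‖ < r → (p₀.1 + u, p₀.2 + v) ∈ E N := by
    intro u v hu hv
    apply hball
    rw [Metric.mem_ball, Prod.dist_eq, dist_eq_norm, dist_eq_norm]
    simpa using ⟨hu, hv⟩
  -- four-point polarisation: small pairs are uniformly bounded
  have key : ∀ k ≥ N, ∀ j, ∀ u v : X, ‖u‖ < r → ‖v‖ < r → |b k j u v| ≤ 4 * N * w k j := by
    intro k hk j u v hu hv
    have h0 : ‖(0 : X)‖ < r := by simpa using hr
    have h1 := abs_le.mp (mem u v hu hv k hk j)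
    have h2 := abs_le.mp (mem u 0 hu h0 k hk j)
    have h3 := abs_le.mp (mem 0 v h0 hv k hk j)
    have h4 := abs_le.mp (mem 0 0 h0 h0 k hk j)
    simp only [add_zero] at h1 h2 h3 h4
    have expand : b k j u v =
        b k j (p₀.1 + u) (p₀.2 + v) - b k j (p₀.1 + u) p₀.2 - b k j p₀.1 (p₀.2 + v) + b k j p₀.1 p₀.2 := by
      simp [map_add]; try ring
    rw [expand, abs_le]
    constructor <;> linarith [h1.1, h1.2, h2.1, h2.2, h3.1, h3.2, h4.1, h4.2]
  -- scaling
  refine ⟨16 * N / r ^ 2, N, fun k hk j x y => ?_⟩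
  have hwk := (hw k j).le
  by_cases hx : x = 0
  · simp [hx]
  by_cases hy : y = 0
  · simp [hy]
  have hxn : 0 < ‖x‖ := norm_pos_iff.mpr hx
  have hyn : 0 < ‖y‖ := norm_pos_iff.mpr hy
  set cx : ℝ := r / (2 * ‖x‖) with hcx
  set cy : ℝ := r / (2 * ‖y‖) with hcy
  have hcxpos : 0 < cx := by positivity
  have hcypos : 0 < cy := by positivity
  have hu : ‖cx • x‖ < r := by
    rw [norm_smul, Real.norm_of_nonneg hcxpos.le, hcx, div_mul_eq_mul_div,
      mul_div_mul_right r 2 hxn.ne']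
    linarith
  have hv : ‖cy • y‖ < r := by
    rw [norm_smul, Real.norm_of_nonneg hcypos.le, hcy, div_mul_eq_mul_div,
      mul_div_mul_right r 2 hyn.ne']
    linarith
  have hb : b k j (cx • x) (cy • y) = (cx * cy) * b k j x y := by
    simp [map_smul]; ring
  have hkey := key k hk j (cx • x) (cy • y) hu hv
  rw [hb, abs_mul, abs_of_pos (mul_pos hcxpos hcypos)] at hkey
  -- hkey : cx * cy * |b x y| ≤ 4 N w, with cx * cy = r² / (4 ‖x‖ ‖y‖)
  have hcc : cx * cy = r ^ 2 / (4 * (‖x‖ * ‖y‖)) := by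
    rw [hcx, hcy]; field_simp; ring
  rw [hcc] at hkey
  have hpos : 0 < r ^ 2 / (4 * (‖x‖ * ‖y‖)) := by positivity
  have hfin : |b k j x y| ≤ 4 * N * w k j / (r ^ 2 / (4 * (‖x‖ * ‖y‖))) := by
    rw [le_div_iff₀ hpos]
    simpa [mul_comm] using hkey
  calc |b k j x y| ≤ 4 * N * w k j / (r ^ 2 / (4 * (‖x‖ * ‖y‖))) := hfin
    _ = 16 * N / r ^ 2 * ‖x‖ * ‖y‖ * w k j := by
      field_simp
      ring

end Summit.QuantumFields.QCD.Cruxes.ContinuumFromLatticeGap.Ideator1
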